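import Summits.MatrixMultiplication.OmegaCensus.VertexCountingSubFourShape
import Summits.MatrixMultiplication.OmegaCensus.TPPSaturation
import Summits.MatrixMultiplication.OmegaCensus.NearTilingPeriodic
import Summits.MatrixMultiplication.OmegaCensus.DicyclicLawQuotientCyclic
import HarnessLib

/-!
# The mod-12 gap: `4 ∣ |S||T||U|` or `3|S||T||U| + 32 ≤ 8|A|` for every dihedral-like group with `|A| ≥ 52`

ω-census, family (b3).  Framing: lottery ticket; floor = certified bounds/negative ranges.

Let `G` have a dihedral-like presentation `ρ, τ : A → G` (`Dih(A)` for `c₀ = 0`, dicyclic type for `c₀ ≠ 0`), `N = |A|`,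
and let `(S,T,U)` be a TPP triple of volume `V = |S||T||U|`, total slack `D = 8N − 3V` (`≥ 0` by vertex counting).
`DihedralLikeLawGap.lean` proved `4 ∣ D ∨ D ≥ 14` (`N ≥ 14`).  From `VertexCountingGap12.lean`:

**Theorem (`tpp_volume_gap12_dihedralLike`, `N ≥ 52`).** `4 ∣ V` or `D ≥ 32`; i.e. `D ≡ 8N (mod 12)` unless `D ≥ 32`.

**Corollaries (by residue, `N ≥ 52`).**
* `tpp_volume_mod_one_gap12` (`N ≡ 1 (mod 3)`, law `(8N−8)/3`): `V = law`, `V = law − 4`, or `V ≤ law − 8` — the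
  volumes `law − 1, −2, −3, −5, −6, −7` never occur (before: only `law − 1` excluded, `tpp_volume_mod_one_gap`).
* `tpp_volume_mod_two_gap12` (`N ≡ 2 (mod 3)`, law `(8N−4)/3`): `D ∈ {4, 16, 28}` or `D ≥ 32`, i.e.
  `V ∈ {law, law − 4, law − 8}` or `V ≤ law − 10` (before: `D = 4` or `D ≥ 16`).
* `tpp_volume_mod_zero_gap12` (`3 ∣ N`, law `8N/3`): `D ∈ {0, 12, 24}` or `D ≥ 32`.

**Dicyclic type (`c₀ ≠ 0`, `N ≡ 1 (mod 3)`).**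
* `quot_cyclic_of_two_two_sub_four` (`N ≥ 14`): a `law − 4` triple with two dominoes (`S`, `T` one element in each
  coset) SATURATES: `(S, T, U ∪ Uρ(c₀))` is TPP (`tpp_saturate`), `|U| = (2N−5)/3` is odd so `U` is not
  `ρ(c₀)`-stable (`card_even_of_periodic`), hence `|U ∪ Uρ(c₀)| = |U| + 1` and the saturated triple attains the LAW;
  by `quot_cyclic_of_mod_one_law_of_c0_ne_zero`, `A/⟨c₀⟩` is cyclic.
* `sub_four_shape_of_quot_noncyclic` / `tpp_volume_dicyclic_quot_noncyclic` (`N ≥ 52`, `A/⟨c₀⟩` NOT cyclic — e.g.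
  `C₂ × Q_{4m}`, `m` even): every TPP triple has `V ≤ law − 8`, or `V = law − 4` with part shape P3/P5 of
  `VertexCountingSubFourShape.lean` (`(c+1, c | d,d | e,e)`, `de ∈ {3,5}`), which forces `N ≡ 7 (mod 9)` or
  `N ≡ 10 (mod 15)`.  Application: `C2QuaternionLawModSixFour.lean`.
-/

namespace Summit.MatrixMultiplication.OmegaCensus

open Literature.Combinatorics.Additive Finset

section DihedralLike

variable {A : Type*} [AddCommGroup A] [DecidableEq A] [Fintype A] {G : Type} [Group G] [DecidableEq G]
  {ρ τ : A → G} {c₀ : A} {S T U : Finset G}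

/-- **The mod-12 gap theorem**: for `|A| ≥ 52`, a TPP triple of a dihedral-like group has `4 ∣ |S||T||U|` or
`3|S||T||U| + 32 ≤ 8|A|`. [folklore] -/
theorem tpp_volume_gap12_dihedralLike
    (hρρ : ∀ a b, ρ a * ρ b = ρ (a + b)) (hρτ : ∀ a b, ρ a * τ b = τ (b - a))
    (hτρ : ∀ a b, τ a * ρ b = τ (a + b)) (hττ : ∀ a b, τ a * τ b = ρ (c₀ + b - a))
    (hρ : Function.Injective ρ) (hτ : Function.Injective τ) (hne : ∀ a b, ρ a ≠ τ b)
    (hsurj : ∀ g, (∃ a, ρ a = g) ∨ (∃ a, τ a = g)) (hA : 52 ≤ Fintype.card A) (h : TripleProductProperty S T U) :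
    4 ∣ S.card * T.card * U.card ∨ 3 * (S.card * T.card * U.card) + 32 ≤ 8 * Fintype.card A := by
  obtain ⟨h000, h111, h100, h011, h010, h101, h001, h110⟩ := vertex_counting' hρρ hρτ hτρ hττ hρ hτ hne h
  rw [card_eq_parts' hρ hτ hne hsurj S, card_eq_parts' hρ hτ hne hsurj T, card_eq_parts' hρ hτ hne hsurj U]
  set s₀ := (univ.filter fun a : A => ρ a ∈ S).card
  set s₁ := (univ.filter fun a : A => τ a ∈ S).card
  set t₀ := (univ.filter fun a : A => ρ a ∈ T).card
  set t₁ := (univ.filter fun a : A => τ a ∈ T).card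
  set u₀ := (univ.filter fun a : A => ρ a ∈ U).card
  set u₁ := (univ.filter fun a : A => τ a ∈ U).card
  by_cases hD : 8 * Fintype.card A ≤ 3 * ((s₀ + s₁) * (t₀ + t₁) * (u₀ + u₁)) + 31
  · left
    exact four_dvd_volume_of_vertex_bounds31 _ _ _ _ _ _ _ h000 h111 h100 h011 h010 h101 h001 h110 (by omega) hD
  · right; omega

/-- **`|A| ≡ 1 (mod 3)`, `|A| ≥ 52`: `V = law`, `V = law − 4` or `V ≤ law − 8`** (`law = (8|A| − 8)/3`): total slack
`8`, `20` or at least `32`. [folklore] -/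
theorem tpp_volume_mod_one_gap12
    (hρρ : ∀ a b, ρ a * ρ b = ρ (a + b)) (hρτ : ∀ a b, ρ a * τ b = τ (b - a))
    (hτρ : ∀ a b, τ a * ρ b = τ (a + b)) (hττ : ∀ a b, τ a * τ b = ρ (c₀ + b - a))
    (hρ : Function.Injective ρ) (hτ : Function.Injective τ) (hne : ∀ a b, ρ a ≠ τ b)
    (hsurj : ∀ g, (∃ a, ρ a = g) ∨ (∃ a, τ a = g)) (hmod : Fintype.card A % 3 = 1) (hA : 52 ≤ Fintype.card A)
    (h : TripleProductProperty S T U) :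
    3 * (S.card * T.card * U.card) + 8 = 8 * Fintype.card A ∨ 3 * (S.card * T.card * U.card) + 20 = 8 * Fintype.card A ∨
      3 * (S.card * T.card * U.card) + 32 ≤ 8 * Fintype.card A := by
  have hle := three_volume_le_of_vertex_counting hρρ hρτ hτρ hττ hρ hτ hne hsurj h
  rcases tpp_volume_gap12_dihedralLike hρρ hρτ hτρ hττ hρ hτ hne hsurj hA h with ⟨k, hk⟩ | h32
  · rw [hk] at hle ⊢; omega
  · exact Or.inr (Or.inr h32)

/-- **`|A| ≡ 2 (mod 3)`, `|A| ≥ 52`: total slack `4` (the law `(8|A|−4)/3`), `16`, `28`, or at least `32`.** [folklore] -/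
theorem tpp_volume_mod_two_gap12
    (hρρ : ∀ a b, ρ a * ρ b = ρ (a + b)) (hρτ : ∀ a b, ρ a * τ b = τ (b - a))
    (hτρ : ∀ a b, τ a * ρ b = τ (a + b)) (hττ : ∀ a b, τ a * τ b = ρ (c₀ + b - a))
    (hρ : Function.Injective ρ) (hτ : Function.Injective τ) (hne : ∀ a b, ρ a ≠ τ b)
    (hsurj : ∀ g, (∃ a, ρ a = g) ∨ (∃ a, τ a = g)) (hmod : Fintype.card A % 3 = 2) (hA : 52 ≤ Fintype.card A)
    (h : TripleProductProperty S T U) :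
    3 * (S.card * T.card * U.card) + 4 = 8 * Fintype.card A ∨ 3 * (S.card * T.card * U.card) + 16 = 8 * Fintype.card A ∨
      3 * (S.card * T.card * U.card) + 28 = 8 * Fintype.card A ∨ 3 * (S.card * T.card * U.card) + 32 ≤ 8 * Fintype.card A := by
  have hle := three_volume_le_of_vertex_counting hρρ hρτ hτρ hττ hρ hτ hne hsurj h
  rcases tpp_volume_gap12_dihedralLike hρρ hρτ hτρ hττ hρ hτ hne hsurj hA h with ⟨k, hk⟩ | h32
  · rw [hk] at hle ⊢; omega
  · exact Or.inr (Or.inr (Or.inr h32))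

/-- **`3 ∣ |A|`, `|A| ≥ 52`: total slack `0` (the law `8|A|/3`), `12`, `24`, or at least `32`.** [folklore] -/
theorem tpp_volume_mod_zero_gap12
    (hρρ : ∀ a b, ρ a * ρ b = ρ (a + b)) (hρτ : ∀ a b, ρ a * τ b = τ (b - a))
    (hτρ : ∀ a b, τ a * ρ b = τ (a + b)) (hττ : ∀ a b, τ a * τ b = ρ (c₀ + b - a))
    (hρ : Function.Injective ρ) (hτ : Function.Injective τ) (hne : ∀ a b, ρ a ≠ τ b)
    (hsurj : ∀ g, (∃ a, ρ a = g) ∨ (∃ a, τ a = g)) (hmod : Fintype.card A % 3 = 0) (hA : 52 ≤ Fintype.card A)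
    (h : TripleProductProperty S T U) :
    3 * (S.card * T.card * U.card) = 8 * Fintype.card A ∨ 3 * (S.card * T.card * U.card) + 12 = 8 * Fintype.card A ∨
      3 * (S.card * T.card * U.card) + 24 = 8 * Fintype.card A ∨ 3 * (S.card * T.card * U.card) + 32 ≤ 8 * Fintype.card A := by
  have hle := three_volume_le_of_vertex_counting hρρ hρτ hτρ hττ hρ hτ hne hsurj h
  rcases tpp_volume_gap12_dihedralLike hρρ hρτ hτρ hττ hρ hτ hne hsurj hA h with ⟨k, hk⟩ | h32
  · rw [hk] at hle ⊢; omega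
  · exact Or.inr (Or.inr (Or.inr h32))

/-! ## Dicyclic type: saturation of the two-domino `law − 4` triples -/

/-- **A two-domino `law − 4` triple saturates to a law triple; hence `A/⟨c₀⟩ is cyclic`** (dicyclic type `c₀ ≠ 0`,
`|A| ≡ 1 (mod 3)`, `|A| ≥ 14`): if `S`, `T` meet each coset in one element and `3|S||T||U| + 20 = 8|A|`, then there is
`g` with `A = ⟨g⟩ ∪ (c₀ + ⟨g⟩)`. [folklore] -/
theorem quot_cyclic_of_two_two_sub_four
    (hρρ : ∀ a b, ρ a * ρ b = ρ (a + b)) (hρτ : ∀ a b, ρ a * τ b = τ (b - a))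
    (hτρ : ∀ a b, τ a * ρ b = τ (a + b)) (hττ : ∀ a b, τ a * τ b = ρ (c₀ + b - a)) (hc₀ : c₀ ≠ 0)
    (hρ : Function.Injective ρ) (hτ : Function.Injective τ) (hne : ∀ a b, ρ a ≠ τ b)
    (hsurj : ∀ g, (∃ a, ρ a = g) ∨ (∃ a, τ a = g)) (hmod : Fintype.card A % 3 = 1) (hA : 14 ≤ Fintype.card A)
    (h : TripleProductProperty S T U)
    (hs₀ : (univ.filter fun a : A => ρ a ∈ S).card = 1) (hs₁ : (univ.filter fun a : A => τ a ∈ S).card = 1)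
    (ht₀ : (univ.filter fun a : A => ρ a ∈ T).card = 1) (ht₁ : (univ.filter fun a : A => τ a ∈ T).card = 1)
    (hV : 3 * (S.card * T.card * U.card) + 20 = 8 * Fintype.card A) :
    ∃ g : A, ∀ x : A, x ∈ AddSubgroup.zmultiples g ∨ x + c₀ ∈ AddSubgroup.zmultiples g := by
  set z : G := ρ c₀ with hz
  have h2c := two_c0_eq_zero hρτ hτρ hττ hτ
  have hzc : ∀ g, Commute z g := commute_rho_c0 hρρ hρτ hτρ hττ hτ hsurj
  have hzz : z * z = 1 := rho_c0_mul_self hρρ hρτ hτρ hττ hτ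
  have hsat := tpp_saturate hzc hzz (domino_quot_stable hρρ hρτ hτρ hττ hτ hne hsurj hs₀ hs₁)
    (domino_quot_stable hρρ hρτ hτρ hττ hτ hne hsurj ht₀ ht₁) h
  have hle := tpp_volume_le_law_dihedralLike_mod_one hρρ hρτ hτρ hττ hρ hτ hne hsurj hmod (by omega) hsat
  have cS : S.card = 2 := by rw [card_eq_parts' hρ hτ hne hsurj S, hs₀, hs₁]
  have cT : T.card = 2 := by rw [card_eq_parts' hρ hτ hne hsurj T, ht₀, ht₁]
  rw [cS, cT] at hV hle
  -- `U` is not `z`-stable: its parts would be `c₀`-periodic, of even size, but `|U| = (2|A| − 5)/3` is odd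
  have hgrow : ¬ (U ∪ U.image (· * z)).card ≤ U.card := by
    intro hUU
    have hsub : U.image (· * z) ⊆ U := fun x hx =>
      (eq_of_subset_of_card_le subset_union_left hUU).symm ▸ mem_union_right _ hx
    have memz : ∀ x ∈ U, x * z ∈ U := fun x hx => hsub (mem_image_of_mem _ hx)
    have hper₀ : (univ.filter fun a : A => ρ a ∈ U).image (· + c₀) = (univ.filter fun a : A => ρ a ∈ U) := by
      apply eq_of_subset_of_card_le _ (by rw [card_image_of_injective _ (add_left_injective c₀)])
      intro x hx
      obtain ⟨a, ha, rfl⟩ := mem_image.1 hx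
      refine mem_filter.2 ⟨mem_univ _, ?_⟩
      have := memz _ (mem_filter.1 ha).2
      rwa [hz, hρρ] at this
    have hper₁ : (univ.filter fun a : A => τ a ∈ U).image (· + c₀) = (univ.filter fun a : A => τ a ∈ U) := by
      apply eq_of_subset_of_card_le _ (by rw [card_image_of_injective _ (add_left_injective c₀)])
      intro x hx
      obtain ⟨a, ha, rfl⟩ := mem_image.1 hx
      refine mem_filter.2 ⟨mem_univ _, ?_⟩
      have := memz _ (mem_filter.1 ha).2
      rwa [hz, hτρ] at this
    obtain ⟨k₀, hk₀⟩ := card_even_of_periodic hper₀ hc₀ h2c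
    obtain ⟨k₁, hk₁⟩ := card_even_of_periodic hper₁ hc₀ h2c
    have cU := card_eq_parts' hρ hτ hne hsurj U
    rw [hk₀, hk₁] at cU
    omega
  -- so the saturated triple attains the law
  have hVsat : 3 * (S.card * T.card * (U ∪ U.image (· * z)).card) + 8 = 8 * Fintype.card A := by
    rw [cS, cT]; omega
  exact quot_cyclic_of_mod_one_law_of_c0_ne_zero hρρ hρτ hτρ hττ hc₀ hρ hτ hne hsurj hmod hA hsat hVsat

/-- **Shapes of the `law − 4` triples when `A/⟨c₀⟩` is not cyclic** (dicyclic type `c₀ ≠ 0`, `|A| ≡ 1 (mod 3)`,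
`|A| ≥ 52`): P3 or P5 — up to the roles of the three sets the coset parts are `(c+1, c | d,d | e,e)` with `de ∈ {3, 5}`;
the two-domino shape P1 is excluded by `quot_cyclic_of_two_two_sub_four`. [folklore] -/
theorem sub_four_shape_of_quot_noncyclic
    (hρρ : ∀ a b, ρ a * ρ b = ρ (a + b)) (hρτ : ∀ a b, ρ a * τ b = τ (b - a))
    (hτρ : ∀ a b, τ a * ρ b = τ (a + b)) (hττ : ∀ a b, τ a * τ b = ρ (c₀ + b - a)) (hc₀ : c₀ ≠ 0)
    (hnq : ¬ ∃ g : A, ∀ x : A, x ∈ AddSubgroup.zmultiples g ∨ x + c₀ ∈ AddSubgroup.zmultiples g)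
    (hρ : Function.Injective ρ) (hτ : Function.Injective τ) (hne : ∀ a b, ρ a ≠ τ b)
    (hsurj : ∀ g, (∃ a, ρ a = g) ∨ (∃ a, τ a = g)) (hmod : Fintype.card A % 3 = 1) (hA : 52 ≤ Fintype.card A)
    (h : TripleProductProperty S T U) (hV : 3 * (S.card * T.card * U.card) + 20 = 8 * Fintype.card A) :
    let s₀ := (univ.filter fun a : A => ρ a ∈ S).card
    let s₁ := (univ.filter fun a : A => τ a ∈ S).card
    let t₀ := (univ.filter fun a : A => ρ a ∈ T).card
    let t₁ := (univ.filter fun a : A => τ a ∈ T).card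
    let u₀ := (univ.filter fun a : A => ρ a ∈ U).card
    let u₁ := (univ.filter fun a : A => τ a ∈ U).card
    (t₀ = t₁ ∧ u₀ = u₁ ∧ (t₀ * u₀ = 3 ∨ t₀ * u₀ = 5) ∧ (s₀ = s₁ + 1 ∨ s₁ = s₀ + 1)) ∨
    (s₀ = s₁ ∧ u₀ = u₁ ∧ (s₀ * u₀ = 3 ∨ s₀ * u₀ = 5) ∧ (t₀ = t₁ + 1 ∨ t₁ = t₀ + 1)) ∨
    (s₀ = s₁ ∧ t₀ = t₁ ∧ (s₀ * t₀ = 3 ∨ s₀ * t₀ = 5) ∧ (u₀ = u₁ + 1 ∨ u₁ = u₀ + 1)) := by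
  intro s₀ s₁ t₀ t₁ u₀ u₁
  have hshape := mod_one_sub_four_shape hρρ hρτ hτρ hττ hρ hτ hne hsurj hA h hV
  simp only at hshape
  have hA14 : 14 ≤ Fintype.card A := by omega
  -- the volume identities for the rotated triples
  have hV_TUS : 3 * (T.card * U.card * S.card) + 20 = 8 * Fintype.card A := by
    rw [show T.card * U.card * S.card = S.card * T.card * U.card by ring]; exact hV
  have hV_UST : 3 * (U.card * S.card * T.card) + 20 = 8 * Fintype.card A := by
    rw [show U.card * S.card * T.card = S.card * T.card * U.card by ring]; exact hV
  rcases hshape with ⟨et, eu, hcase⟩ | ⟨es, eu, hcase⟩ | ⟨es, et, hcase⟩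
  · -- `T`, `U` balanced, `S` the odd pair
    rcases hcase with ⟨hp, -⟩ | ⟨hp, hδ⟩
    · -- P1: `T`, `U` dominoes — saturation, roles `(T, U, S)`
      have ht := Nat.eq_one_of_mul_eq_one_right hp
      have hu := Nat.eq_one_of_mul_eq_one_left hp
      exact absurd (quot_cyclic_of_two_two_sub_four hρρ hρτ hτρ hττ hc₀ hρ hτ hne hsurj hmod hA14 h.rotate
        ht (by omega) hu (by omega) hV_TUS) hnq
    · exact Or.inl ⟨et, eu, hp, hδ⟩
  · -- `S`, `U` balanced, `T` the odd pair
    rcases hcase with ⟨hp, -⟩ | ⟨hp, hδ⟩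
    · have hs := Nat.eq_one_of_mul_eq_one_right hp
      have hu := Nat.eq_one_of_mul_eq_one_left hp
      exact absurd (quot_cyclic_of_two_two_sub_four hρρ hρτ hτρ hττ hc₀ hρ hτ hne hsurj hmod hA14 h.rotate.rotate
        hu (by omega) hs (by omega) hV_UST) hnq
    · exact Or.inr (Or.inl ⟨es, eu, hp, hδ⟩)
  · -- `S`, `T` balanced, `U` the odd pair
    rcases hcase with ⟨hp, -⟩ | ⟨hp, hδ⟩
    · have hs := Nat.eq_one_of_mul_eq_one_right hp
      have ht := Nat.eq_one_of_mul_eq_one_left hp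
      exact absurd (quot_cyclic_of_two_two_sub_four hρρ hρτ hτρ hττ hc₀ hρ hτ hne hsurj hmod hA14 h
        hs (by omega) ht (by omega) hV) hnq
    · exact Or.inr (Or.inr ⟨es, et, hp, hδ⟩)

/-- **Dicyclic type with `A/⟨c₀⟩` not cyclic** (`c₀ ≠ 0`, `|A| ≡ 1 (mod 3)`, `|A| ≥ 52`; e.g. `C₂ × Q_{4m}`, `m` even):
every TPP triple has `3|S||T||U| + 32 ≤ 8|A|` (`V ≤ law − 8`), or `3|S||T||U| + 20 = 8|A|` (`V = law − 4`) and then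
`|A| ≡ 7 (mod 9)` or `|A| ≡ 10 (mod 15)` (shapes P3/P5: `|A| = 9c + 7` resp. `15c + 10`). [folklore] -/
theorem tpp_volume_dicyclic_quot_noncyclic
    (hρρ : ∀ a b, ρ a * ρ b = ρ (a + b)) (hρτ : ∀ a b, ρ a * τ b = τ (b - a))
    (hτρ : ∀ a b, τ a * ρ b = τ (a + b)) (hττ : ∀ a b, τ a * τ b = ρ (c₀ + b - a)) (hc₀ : c₀ ≠ 0)
    (hnq : ¬ ∃ g : A, ∀ x : A, x ∈ AddSubgroup.zmultiples g ∨ x + c₀ ∈ AddSubgroup.zmultiples g)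
    (hρ : Function.Injective ρ) (hτ : Function.Injective τ) (hne : ∀ a b, ρ a ≠ τ b)
    (hsurj : ∀ g, (∃ a, ρ a = g) ∨ (∃ a, τ a = g)) (hmod : Fintype.card A % 3 = 1) (hA : 52 ≤ Fintype.card A)
    (h : TripleProductProperty S T U) :
    3 * (S.card * T.card * U.card) + 32 ≤ 8 * Fintype.card A ∨
      (3 * (S.card * T.card * U.card) + 20 = 8 * Fintype.card A ∧ (Fintype.card A % 9 = 7 ∨ Fintype.card A % 15 = 10)) := by
  rcases tpp_volume_mod_one_gap12 hρρ hρτ hτρ hττ hρ hτ hne hsurj hmod hA h with hlaw | h20 | h32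
  · exact absurd (quot_cyclic_of_mod_one_law_of_c0_ne_zero hρρ hρτ hτρ hττ hc₀ hρ hτ hne hsurj hmod (by omega) h hlaw)
      hnq
  · right
    refine ⟨h20, ?_⟩
    have hshape := sub_four_shape_of_quot_noncyclic hρρ hρτ hτρ hττ hc₀ hnq hρ hτ hne hsurj hmod hA h h20
    simp only at hshape
    set s₀ := (univ.filter fun a : A => ρ a ∈ S).card with hs₀
    set s₁ := (univ.filter fun a : A => τ a ∈ S).card with hs₁
    set t₀ := (univ.filter fun a : A => ρ a ∈ T).card with ht₀
    set t₁ := (univ.filter fun a : A => τ a ∈ T).card with ht₁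
    set u₀ := (univ.filter fun a : A => ρ a ∈ U).card with hu₀
    set u₁ := (univ.filter fun a : A => τ a ∈ U).card with hu₁
    have cS : S.card = s₀ + s₁ := card_eq_parts' hρ hτ hne hsurj S
    have cT : T.card = t₀ + t₁ := card_eq_parts' hρ hτ hne hsurj T
    have cU : U.card = u₀ + u₁ := card_eq_parts' hρ hτ hne hsurj U
    rw [cS, cT, cU] at h20
    rcases hshape with ⟨et, eu, hp, -⟩ | ⟨es, eu, hp, -⟩ | ⟨es, et, hp, -⟩
    · rw [← et, ← eu] at h20
      have e4 : (s₀ + s₁) * (t₀ + t₀) * (u₀ + u₀) = 4 * (t₀ * u₀) * (s₀ + s₁) := by ring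
      rw [e4] at h20
      rcases hp with hp | hp <;> rw [hp] at h20 <;> omega
    · rw [← es, ← eu] at h20
      have e4 : (s₀ + s₀) * (t₀ + t₁) * (u₀ + u₀) = 4 * (s₀ * u₀) * (t₀ + t₁) := by ring
      rw [e4] at h20
      rcases hp with hp | hp <;> rw [hp] at h20 <;> omega
    · rw [← es, ← et] at h20
      have e4 : (s₀ + s₀) * (t₀ + t₀) * (u₀ + u₁) = 4 * (s₀ * t₀) * (u₀ + u₁) := by ring
      rw [e4] at h20
      rcases hp with hp | hp <;> rw [hp] at h20 <;> omega
  · exact Or.inl h32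

end DihedralLike

end Summit.MatrixMultiplication.OmegaCensus
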